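import Summits.Ventures.Crystal3D.Theorems.StickyWulffConstantPolycrystalWulffBoundPerSelf
import Summits.Ventures.Crystal3D.Theses.StickyWulffConstant
import Summits.Ventures.Crystal3D.Theorems.StickyWulffConstantLiminfAssemblySplit

/-!
# `TextureLiminf` follows from `SurfaceLiminf`: the v4 split of `LiminfAssembly` loses nothing

Route `StickyWulffConstant` of the venture `Summits/Ventures/Crystal3D`. `LiminfAssembly`
(`= NoReconstructionGain → StackingLiminf → SurfaceLiminf`, item 19146) was split (v4) into
G `GenericWallFloor` (19480), F `CoaxialWallLaw` (19481), P `PolycrystalWulffBound` (19482) and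
T `TextureLiminf` (19483) with the PROVED glue `LiminfAssemblySplit : G → F → P → T → LiminfAssembly`
(`liminfAssemblySplit_proof`). This file proves the converse sanity statement of cf-p1's T-NOTE §1,
now UNCONDITIONAL (its bracket `Per_W(W) = 96` is `per_cruxWulffBody_self`):

* `textureLiminf_of_surfaceLiminf : SurfaceLiminf → TextureLiminf`,
* `textureLiminf_of_liminfAssembly : LiminfAssembly → TextureLiminf`;

so, given G, F and P, «T ⟺ LiminfAssembly»: T as typed is EXACTLY its share of the goal, neither
more (this file) nor less (the glue). Proof: T's conclusion is witnessed by the single texture «one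
Wulff grain of mass one» (`polycrystalWulffBound_wulffGrain`: admissible, `√2·Vol = 1`, energy
`6·2^{1/3}` = equality in P), and `SurfaceLiminf` with `ε = θ` bounds the deficiency below by
`(6·2^{1/3} − θ)·N^{2/3}` eventually along any sequence `N_k → ∞` (`φ = id`).
WHAT THIS IS NOT: a proof of T (T is open: it needs bulk crystallinity / compactness, T-NOTE §2);
F-C1 not moved.
-/

noncomputable section

namespace Summit.Ventures.Crystal3D.Theorems

open MeasureTheory Set Filter
open scoped RealInnerProductSpace ENNReal Pointwise
open Literature.MathematicalPhysics.StatisticalMechanics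

/-! ### Sanity of the v4 split: `SurfaceLiminf ⟹ TextureLiminf` -/

/-- **The split loses nothing: `SurfaceLiminf → TextureLiminf`.** Given the full surface liminf
`κ_N → 6·2^{1/3}`, the compactness half T of the v4 split holds with the SINGLE texture «one Wulff
grain of mass one» (`x₀ = 0`, `A = 1`, `r = (32√2)^{-1/3}`): it is admissible, has mass
`√2·32 r³ = 1 ≥ 1 − δ` and energy exactly `6·2^{1/3}` (`polycrystalWulffBound_wulffGrain`), while
`SurfaceLiminf` makes `deficiency/N^{2/3} ≥ 6·2^{1/3} − θ` eventually along ANY sequence with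
`N_k → ∞` (no subsequence needed: `φ = id`). With the proved glue
`LiminfAssemblySplit : G → F → P → T → LiminfAssembly` this certifies «given G, F, P:
T ⟺ LiminfAssembly» (cf-p1 T-NOTE §1). -/
theorem textureLiminf_of_surfaceLiminf
    (hSL : Summit.Ventures.Crystal3D.Theses.StickyWulffConstant.SurfaceLiminf) :
    Summit.Ventures.Crystal3D.Theses.StickyWulffConstant.TextureLiminf := by
  unfold Summit.Ventures.Crystal3D.Theses.StickyWulffConstant.TextureLiminf
  intro Λ Brl Ax CoAx Φ Per ι W Dsc Tex En Vol _ _ _ _ K δ θ hδ hθ Nseq x hx hN _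
  -- the Wulff grain of mass one: `√2·32·r³ = 1`
  obtain ⟨r, hr, hr3⟩ : ∃ r : ℝ, 0 < r ∧ Real.sqrt 2 * (32 * r ^ 3) = 1 := by
    refine ⟨((32 * Real.sqrt 2)⁻¹) ^ ((1 : ℝ) / 3), by positivity, ?_⟩
    rw [← Real.rpow_mul_natCast (by positivity)]
    norm_num
    have h2 : (0 : ℝ) < Real.sqrt 2 := Real.sqrt_pos.2 (by norm_num)
    field_simp
  obtain ⟨hTex, -, hVol, hEq⟩ := polycrystalWulffBound_wulffGrain
    (LinearIsometryEquiv.refl ℝ (EuclideanSpace ℝ (Fin 3))) 0 r hr (fun _ _ => 0) (fun _ _ => 0)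
  -- the same facts, re-typed in this statement's `let`-context
  have hTex' : Tex 1 (fun _ => (0 : EuclideanSpace ℝ (Fin 3)) +ᵥ (r • W (LinearIsometryEquiv.refl ℝ _)))
      (fun _ => LinearIsometryEquiv.refl ℝ _) (fun _ _ => 0) (fun _ _ => 0) := hTex
  have hVol' : Vol 1 (fun _ => (0 : EuclideanSpace ℝ (Fin 3)) +ᵥ (r • W (LinearIsometryEquiv.refl ℝ _))) =
      32 * r ^ 3 := hVol
  have hEq' : 6 * (2 : ℝ) ^ ((1 : ℝ) / 3) * (Real.sqrt 2 *
      Vol 1 (fun _ => (0 : EuclideanSpace ℝ (Fin 3)) +ᵥ (r • W (LinearIsometryEquiv.refl ℝ _)))) ^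
        ((2 : ℝ) / 3) =
      En 1 (fun _ => (0 : EuclideanSpace ℝ (Fin 3)) +ᵥ (r • W (LinearIsometryEquiv.refl ℝ _)))
        (fun _ => LinearIsometryEquiv.refl ℝ _) (fun _ _ => 0) (fun _ _ => 0) := hEq
  have hE1 : En 1 (fun _ => (0 : EuclideanSpace ℝ (Fin 3)) +ᵥ (r • W (LinearIsometryEquiv.refl ℝ _)))
      (fun _ => LinearIsometryEquiv.refl ℝ _) (fun _ _ => 0) (fun _ _ => 0) =
      6 * (2 : ℝ) ^ ((1 : ℝ) / 3) := by
    rw [← hEq', hVol', hr3, Real.one_rpow, mul_one]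
  refine ⟨fun k => k, fun a b hab => hab, 1, fun _ => 1,
    fun _ _ => (0 : EuclideanSpace ℝ (Fin 3)) +ᵥ (r • W (LinearIsometryEquiv.refl ℝ _)),
    fun _ _ => LinearIsometryEquiv.refl ℝ _, fun _ _ _ => 0, fun _ _ _ => 0, fun _ => hTex', ?_, ?_⟩
  · -- mass `√2 · 32 r³ = 1 ≥ 1 - δ`
    simp only [Finset.univ_unique, Fin.default_eq_zero, Finset.sum_singleton]
    rw [hVol', hr3]
    linarith
  · -- energy `6·2^{1/3}` versus `SurfaceLiminf` with `ε = θ`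
    obtain ⟨N₀, hN₀⟩ := hSL θ hθ
    filter_upwards [hN.eventually_ge_atTop (max N₀ 1)] with k hk
    have hk₀ : N₀ ≤ Nseq k := le_of_max_le_left hk
    have hk₁ : 1 ≤ Nseq k := le_of_max_le_right hk
    have hSLk := hN₀ (Nseq k) hk₀ (x k) (hx k)
    have hNpos : (0 : ℝ) < (Nseq k : ℝ) ^ ((2 : ℝ) / 3) := by
      apply Real.rpow_pos_of_pos; exact_mod_cast hk₁
    simp only [Finset.univ_unique, Fin.default_eq_zero, Finset.sum_singleton]
    rw [hE1, le_div_iff₀ hNpos]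
    exact hSLk

/-- **Corollary: `LiminfAssembly → TextureLiminf`** (T carries `NoReconstructionGain` and
`StackingLiminf` among its hypotheses, which feed `LiminfAssembly = NRG → SL → SurfaceLiminf`). -/
theorem textureLiminf_of_liminfAssembly
    (hLA : Summit.Ventures.Crystal3D.Theses.StickyWulffConstant.LiminfAssembly) :
    Summit.Ventures.Crystal3D.Theses.StickyWulffConstant.TextureLiminf := by
  unfold Summit.Ventures.Crystal3D.Theses.StickyWulffConstant.TextureLiminf
  intro Λ Brl Ax CoAx Φ Per ι W Dsc Tex En Vol hG hF hNRG hStack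
  exact textureLiminf_of_surfaceLiminf (hLA hNRG hStack) hG hF hNRG hStack

/-- **Given G, F and P, `TextureLiminf ⟺ LiminfAssembly`** — the v4 split is exact: the proved
glue `liminfAssemblySplit_proof : G → F → P → T → LiminfAssembly` one way,
`textureLiminf_of_liminfAssembly` the other. -/
theorem textureLiminf_iff_liminfAssembly
    (hG : Summit.Ventures.Crystal3D.Theses.StickyWulffConstant.GenericWallFloor)
    (hF : Summit.Ventures.Crystal3D.Theses.StickyWulffConstant.CoaxialWallLaw)
    (hP : Summit.Ventures.Crystal3D.Theses.StickyWulffConstant.PolycrystalWulffBound) :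
    Summit.Ventures.Crystal3D.Theses.StickyWulffConstant.TextureLiminf ↔
      Summit.Ventures.Crystal3D.Theses.StickyWulffConstant.LiminfAssembly :=
  ⟨liminfAssemblySplit_proof hG hF hP, textureLiminf_of_liminfAssembly⟩

end Summit.Ventures.Crystal3D.Theorems

end
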